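import Summits.QuantumFields.YangMills.Theorems.LuscherReductionTwistedTraceScalingOnionRefinedGlue
import Summits.QuantumFields.YangMills.Theorems.FemtoTransferGapOneSiteScaling
import Summits.QuantumFields.YangMills.Theorems.FemtoCutoffLadderFixedLatticeLawReduction
import HarnessLib

/-!
# The `O(λ_b²)` endgame: the fixed-lattice Lüscher law at ONE lattice size `L` (crux `FixedLatticeLaw` stmt-QuantumFields-23943 ≡ leaf
# `FemtoGapFixedLattice`, route `FemtoCutoffLadder`) ⟸ RED's VALLEY GAIN (verbatim) + a RATE form of RED's INNER NO-INTRUDER + rate-admissible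
# onion scales — the glue of route RED's COARSE-UPPER(L) programme re-run with `e^{C·λ_b(L³β)²}` in place of `∀ ε, e^{ε·λ_b(L³β)}`

Lead seat `ym-line-fcl-p1` g2 (2026-08-28).  Route RED (`LuscherReduction`) reduces its fixed-lattice Born–Oppenheimer text `BOUpperAt L`
(`λ_k μ₀ ≤ e^{ελ_b(L³β)} μ_k λ₀`, all `ε > 0`, eventually) to `ScalesAdmissible₂ + ValleyGainAt + InnerNoIntruderAt` by the onion / IMS endgame
`boUpper_of_valley_inner₂` (`…TwistedTraceScalingOnionRefinedGlue`).  The crux child `FixedLatticeLaw` of THIS route needs the same comparison with a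
RATE, `e^{C·λ_b(L³β)²}` (certificate of the converse gap: `…FemtoCutoffLadderFixedLatticeLawVsCoarse`).  This file proves that RED's endgame carries the
rate with NO new analysis: run it at the `β`-dependent tolerance `ε(β) := 4K·λ_b(L³β)`.

* ★★★ `boUpperRate_of_valley_innerRate` (level `k`): if the scales `δ, η > 0` make the refined onion error `O(λ_b(L³β)²)` in units of the β-uniform
  floor (`onionErr₂ ≤ K·λ_b(L³β)²·uniformFloorConst`, eventually), RED's `ValleyGainAt L δ η` holds, and INNER NO-INTRUDER holds at level `k` WITH A
  RATE (`… ≤ e^{C_I·λ_b(L³β)²}·μ_k·λ₀·‖ψ‖²`), then `∃ C β₀, ∀ β ≥ β₀, λ_k(β,L)·μ₀(L³β) ≤ e^{C·λ_b(L³β)²}·μ_k(L³β)·λ₀(β,L)` — proof = RED's, verbatim,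
  with `ε := 4K'λ_b`, `κ := K'λ_b`, `K' = |K| + |C_I| + 1` (their `endgame_a/b`, `bo_endgame`, `gram_endgame` are abstract in `ε`).
* ★ `onionRate_powScale` — the rate-admissibility IS MET by RED's polynomial scales `(δ, η) = (β^{−p}, β^{−q})` whenever `0 < p ≤ 1/6` and
  `q ≤ 8/9` (IMS term `∝ β^{2p−1} ≤ β^{−2/3}`; Boltzmann terms `e^{−β^{1−q}} ≤ 6!·β^{−6(1−q)} ≤ 6!·β^{−2/3}`) — RED's exponent ledger
  `(p, q) = (1/40, 17/20)` qualifies.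
* ★★ `fixedLReductionAt_of_valley_innerRate` / `femtoGapFixedLatticeAt_of_valley_innerRate` (`k = 1`): the registered hard stub's body at `L`, and
  the LEAF'S BODY at `L`, from `ValleyGainAt L (β^{−p}) (β^{−q})` + INNER-with-rate at `β^{−p}` (crux ONE closed: `oneSiteAtScaledCoupling`).
So crux 23943 = (RED's open VALLEY text, shared verbatim) + (RED's open INNER text, sharpened to a rate) — one engine for both routes.  HONEST FRAMING:
a reduction; VALLEY and INNER-with-rate are OPEN fixed-lattice semiclassics on `SU(2)^{3L³}`; femto rung R2b1 (RECORD label) — not a mass gap, not Clay.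
-/

set_option autoImplicit false

noncomputable section

open MeasureTheory Filter Topology Real
open scoped BigOperators
open Literature.MathematicalPhysics.QuantumFieldTheory hiding SU2
open Literature.MathematicalPhysics.QuantumLattice
open Literature.Analysis.OperatorTheory.YMMatrixModel

namespace Summit.QuantumFields.YangMills.Theorems.FemtoCutoffLadder

open Summit.QuantumFields.YangMills.Theorems.FemtoTransferGap

variable {L : ℕ} [NeZero L]

/-! ## §1 The endgame with a rate -/
set_option maxHeartbeats 400000 in
/-- ★★★ **BO comparison WITH RATE at level `k` from VALLEY GAIN + INNER NO-INTRUDER WITH RATE**, at any scales for which the refined onion error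
is `O(λ_b(L³β)²)·uniformFloorConst`: `∃ C β₀, ∀ β ≥ β₀, λ_k(β,L)·μ₀(L³β) ≤ e^{C·λ_b(L³β)²}·μ_k(L³β)·λ₀(β,L)`.  RED's `boUpper_of_valley_inner₂`
verbatim at the tolerance `ε(β) = 4K'λ_b(L³β)`. [cite: Luscher1983, §3] [cite: SimonB1983DiscreteSpectrum, §3] -/
theorem boUpperRate_of_valley_innerRate (k : ℕ) {δ η : ℝ → ℝ} (hδ : ∀ β, 0 < δ β) (hη : ∀ β, 0 < η β)
    (hErr : ∃ K βE : ℝ, ∀ β : ℝ, βE ≤ β →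
      onionErr₂ L β (δ β) (η β) ≤ K * bareLambda ((L : ℝ) ^ 3 * β) ^ 2 * uniformFloorConst L)
    (hV : ValleyGainAt L δ η)
    (hI : ∃ CI βI : ℝ, ∀ β : ℝ, βI ≤ β →
      ∀ F : Fin (k + 1) → (GaugeConfig 3 L SU2 → ℝ), (∀ i, IsPhys (F i)) →
        (∀ i U, F i U ≠ 0 → ∃ z : Fin 3 → Bool, orbitDist (TT.twist3 z U) < δ β) →
        (∀ a : Fin (k + 1) → ℝ, a ≠ 0 → 0 < l2 (fun U => ∑ i, a i * F i U) (fun U => ∑ i, a i * F i U)) →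
          ∃ a : Fin (k + 1) → ℝ, a ≠ 0 ∧
            qform su2Rep β (fun U => ∑ i, a i * F i U) (fun U => ∑ i, a i * F i U) * levelValue su2Rep 1 ((L : ℝ) ^ 3 * β) 0 ≤
              Real.exp (CI * bareLambda ((L : ℝ) ^ 3 * β) ^ 2) * levelValue su2Rep 1 ((L : ℝ) ^ 3 * β) k *
                levelValue su2Rep L β 0 * l2 (fun U => ∑ i, a i * F i U) (fun U => ∑ i, a i * F i U)) :
    ∃ C β0 : ℝ, ∀ β : ℝ, β0 ≤ β →
      levelValue su2Rep L β k * levelValue su2Rep 1 ((L : ℝ) ^ 3 * β) 0 ≤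
        Real.exp (C * bareLambda ((L : ℝ) ^ 3 * β) ^ 2) * (levelValue su2Rep 1 ((L : ℝ) ^ 3 * β) k * levelValue su2Rep L β 0) := by
  obtain ⟨K, βE, hE⟩ := hErr
  obtain ⟨CI, βI, hI'⟩ := hI
  obtain ⟨C, B0, hONE⟩ := oneSiteLevels_proof k
  obtain ⟨βV, hV'⟩ := hV (levelGap k + 1)
  obtain ⟨K', hK'⟩ : ∃ K' : ℝ, K' = |K| + |CI| + 1 := ⟨_, rfl⟩
  have hK'0 : 0 < K' := by rw [hK']; positivity
  have hKK' : K ≤ K' := by rw [hK']; linarith [le_abs_self K, abs_nonneg CI]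
  have hCK' : CI ≤ 2 * K' := by rw [hK']; linarith [le_abs_self CI, abs_nonneg K, abs_nonneg CI]
  obtain ⟨τ, hτ⟩ : ∃ τ : ℝ, τ = min (1 / (2 * (|levelGap k| + |C| + 2))) (1 / (4 * K')) := ⟨_, rfl⟩
  have hτ0 : 0 < τ := by rw [hτ]; exact lt_min (by positivity) (by positivity)
  refine ⟨4 * K', max (max 1 B0) (max (max βV βI) (max βE (2 / τ ^ 3))), fun β hβ => ?_⟩
  have hβ1 : 1 ≤ β := ((le_max_left _ _).trans (le_max_left _ _)).trans hβ
  have hβ0 : 0 < β := by linarith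
  have hβB0 : B0 ≤ β := ((le_max_right _ _).trans (le_max_left _ _)).trans hβ
  have hβV : βV ≤ β := (((le_max_left _ _).trans (le_max_left _ _)).trans (le_max_right _ _)).trans hβ
  have hβI : βI ≤ β := (((le_max_right _ _).trans (le_max_left _ _)).trans (le_max_right _ _)).trans hβ
  have hβE : βE ≤ β := (((le_max_left _ _).trans (le_max_right _ _)).trans (le_max_right _ _)).trans hβ
  have hβτ : 2 / τ ^ 3 ≤ β := (((le_max_right _ _).trans (le_max_right _ _)).trans (le_max_right _ _)).trans hβ
  -- the natural coupling and the one-site levels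
  have hL1 : (1 : ℝ) ≤ (L : ℝ) ^ 3 := one_le_pow₀ (by exact_mod_cast NeZero.one_le)
  have hB'β : β ≤ (L : ℝ) ^ 3 * β := by nlinarith
  have hB'0 : 0 < (L : ℝ) ^ 3 * β := lt_of_lt_of_le hβ0 hB'β
  obtain ⟨hμ0, -, hμk⟩ := hONE ((L : ℝ) ^ 3 * β) (hβB0.trans hB'β)
  have hlam0 : 0 < bareLambda ((L : ℝ) ^ 3 * β) := bareLambda_pos' hB'0
  have hlamτ : bareLambda ((L : ℝ) ^ 3 * β) ≤ τ := bareLambda_cube_le (L := L) hτ0 hβτ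
  have hlam1 : bareLambda ((L : ℝ) ^ 3 * β) ≤ 1 / (2 * (|levelGap k| + |C| + 2)) := hlamτ.trans (by rw [hτ]; exact min_le_left _ _)
  have hlam2 : bareLambda ((L : ℝ) ^ 3 * β) ≤ 1 / (4 * K') := hlamτ.trans (by rw [hτ]; exact min_le_right _ _)
  have hΛ0 : 0 < levelValue su2Rep L β 0 := levelValue_su2Rep_pos hβ0 0
  obtain ⟨h1, h2, hy⟩ := smallness_of_le hlam0.le hlam1
  -- the β-dependent tolerance ε = 4K'λ and error coefficient κ = K'λ
  have hε : 0 ≤ 4 * K' * bareLambda ((L : ℝ) ^ 3 * β) := by positivity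
  have hκε : K' * bareLambda ((L : ℝ) ^ 3 * β) ≤ 4 * K' * bareLambda ((L : ℝ) ^ 3 * β) / 4 := by linarith
  have hκ4 : K' * bareLambda ((L : ℝ) ^ 3 * β) ≤ 1 / 4 := by
    have := mul_le_mul_of_nonneg_left hlam2 hK'0.le
    rwa [show K' * (1 / (4 * K')) = 1 / 4 by field_simp] at this
  -- ONE's lower bound with `|C|`, and `μ_k ≥ μ₀/2`
  have hμk' : Real.exp (-(levelGap k * bareLambda ((L : ℝ) ^ 3 * β) + |C| * bareLambda ((L : ℝ) ^ 3 * β) ^ 2)) *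
      levelValue su2Rep 1 ((L : ℝ) ^ 3 * β) 0 ≤ levelValue su2Rep 1 ((L : ℝ) ^ 3 * β) k := by
    refine le_trans (mul_le_mul_of_nonneg_right (Real.exp_le_exp.2 ?_) hμ0.le) hμk
    have := mul_le_mul_of_nonneg_right (le_abs_self C) (sq_nonneg (bareLambda ((L : ℝ) ^ 3 * β)))
    linarith
  have hμk2 := half_le_of_exp_lower hy hμ0.le hμk'
  -- the error budget through the floor: onionErr₂·c^{|E|} ≤ K λ² fc·c^{|E|} ≤ κ λ λ₀
  have herr : onionErr₂ L β (δ β) (η β) * latCE L β ≤ K' * bareLambda ((L : ℝ) ^ 3 * β) * bareLambda ((L : ℝ) ^ 3 * β) * levelValue su2Rep L β 0 := by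
    have hfc := uniformFloorConst_pos (L := L)
    have hCE := (latCE_pos (L := L) hβ0.le).le
    have h := mul_le_mul_of_nonneg_right (hE β hβE) hCE
    refine h.trans ?_
    have hKlam : K * bareLambda ((L : ℝ) ^ 3 * β) ^ 2 * uniformFloorConst L ≤ K' * bareLambda ((L : ℝ) ^ 3 * β) * bareLambda ((L : ℝ) ^ 3 * β) * uniformFloorConst L := by
      have : K * bareLambda ((L : ℝ) ^ 3 * β) ^ 2 ≤ K' * bareLambda ((L : ℝ) ^ 3 * β) * bareLambda ((L : ℝ) ^ 3 * β) := by
        nlinarith [mul_le_mul_of_nonneg_right hKK' (sq_nonneg (bareLambda ((L : ℝ) ^ 3 * β)))]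
      exact mul_le_mul_of_nonneg_right this hfc.le
    calc K * bareLambda ((L : ℝ) ^ 3 * β) ^ 2 * uniformFloorConst L * latCE L β
        ≤ K' * bareLambda ((L : ℝ) ^ 3 * β) * bareLambda ((L : ℝ) ^ 3 * β) * uniformFloorConst L * latCE L β := mul_le_mul_of_nonneg_right hKlam hCE
      _ = K' * bareLambda ((L : ℝ) ^ 3 * β) * bareLambda ((L : ℝ) ^ 3 * β) * (uniformFloorConst L * latCE L β) := by ring
      _ ≤ K' * bareLambda ((L : ℝ) ^ 3 * β) * bareLambda ((L : ℝ) ^ 3 * β) * levelValue su2Rep L β 0 :=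
          mul_le_mul_of_nonneg_left (levelValue_zero_ge_uniform hβ1) (by positivity)
  -- endgame targets (a), (b), at ε = 4K'λ and κ = K'λ
  have hA := endgame_a hε hlam0.le hμ0.le hμk2 hκε
  have hB := endgame_b (ε := 4 * K' * bareLambda ((L : ℝ) ^ 3 * β)) hε hlam0.le h1 h2 hμ0.le hμk' hκ4
  have hexp : Real.exp (4 * K' * bareLambda ((L : ℝ) ^ 3 * β) ^ 2) = Real.exp (4 * K' * bareLambda ((L : ℝ) ^ 3 * β) * bareLambda ((L : ℝ) ^ 3 * β)) := by
    congr 1; ring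
  rw [hexp]
  -- suppose the rate bound fails at `β`
  by_contra H
  push Not at H
  -- the exact eigenfamily and its inner pieces
  obtain ⟨e, he, hon, heig⟩ := exists_isPhys_eigenfamily_of_pos (L := L) hβ0 k
  obtain ⟨F, hFdef⟩ : ∃ F : Fin (k + 1) → GaugeConfig 3 L SU2 → ℝ, F = fun i U => Real.cos (innerPhase (δ β) U) * e i U := ⟨_, rfl⟩
  have hFphys : ∀ i, IsPhys (F i) := fun i => by rw [hFdef]; exact isPhys_inner (δ β) (he i)
  have hFsupp : ∀ i U, F i U ≠ 0 → ∃ z : Fin 3 → Bool, orbitDist (TT.twist3 z U) < δ β := fun i U h => by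
    rw [hFdef] at h
    exact exists_orbitDist_lt_of_cos_ne_zero (hδ β) (left_ne_zero_of_mul h)
  -- KEY ESTIMATE for every coefficient vector (RED's, verbatim, with the refined onion and the coefficient κ = K'λ)
  have key : ∀ a : Fin (k + 1) → ℝ,
      0 ≤ l2 (fun U => ∑ i, a i * F i U) (fun U => ∑ i, a i * F i U) ∧
      l2 (fun U => ∑ i, a i * F i U) (fun U => ∑ i, a i * F i U) ≤ ∑ i, a i ^ 2 ∧
      levelValue su2Rep L β k * levelValue su2Rep 1 ((L : ℝ) ^ 3 * β) 0 * ∑ i, a i ^ 2 ≤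
        qform su2Rep β (fun U => ∑ i, a i * F i U) (fun U => ∑ i, a i * F i U) * levelValue su2Rep 1 ((L : ℝ) ^ 3 * β) 0
          + Real.exp (-((levelGap k + 1) * bareLambda ((L : ℝ) ^ 3 * β))) * levelValue su2Rep L β 0 *
              levelValue su2Rep 1 ((L : ℝ) ^ 3 * β) 0 * (∑ i, a i ^ 2 - l2 (fun U => ∑ i, a i * F i U) (fun U => ∑ i, a i * F i U))
          + K' * bareLambda ((L : ℝ) ^ 3 * β) * bareLambda ((L : ℝ) ^ 3 * β) * levelValue su2Rep L β 0 * levelValue su2Rep 1 ((L : ℝ) ^ 3 * β) 0 *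
              ∑ i, a i ^ 2 := by
    intro a
    have hψ : IsPhys (fun U => ∑ i, a i * e i U) := isPhys_sum_mul_lat Finset.univ e he a
    obtain ⟨hn, hq⟩ := forms_of_eigenfamily_lat he hon heig a
    have hin : (fun U => Real.cos (innerPhase (δ β) U) * ∑ i, a i * e i U) = fun U => ∑ i, a i * F i U := by
      rw [hFdef]; exact cut_sum_mul _ a e
    -- refined onion
    have honion := qform_le_three_regions_lat₂ hβ0 (hδ β) (hη β) hψ
    rw [hin, hn] at honion
    -- valley
    have hψoutP : IsPhys (fun U => Real.sin (innerPhase (δ β) U) * ∑ i, a i * e i U) := isPhys_outer (δ β) hψ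
    have hVal := hV' β hβV _ (isPhys_valley (η β) hψoutP) fun U hU =>
      valley_support (hδ β) (hη β) (fun U => ∑ i, a i * e i U) hU
    have hvalout := l2_mul_le hψoutP (J := fun U => Real.cos (actionPhase (η β) U)) fun U => Real.abs_cos_le_one _
    have hsplit := l2_cos_add_l2_sin (measurable_innerPhase (δ β)) hψ
    rw [hin, hn] at hsplit
    -- floor of the span
    have hfloorK : levelValue su2Rep L β k * ∑ i, a i ^ 2 ≤ qform su2Rep β (fun U => ∑ i, a i * e i U) (fun U => ∑ i, a i * e i U) := by
      rw [hq, Finset.mul_sum]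
      refine Finset.sum_le_sum fun i _ => mul_le_mul_of_nonneg_right ?_ (sq_nonneg _)
      exact levelValue_le_of_le hβ0 (Nat.le_of_lt_succ i.2)
    have hnin0 : 0 ≤ l2 (fun U => ∑ i, a i * F i U) (fun U => ∑ i, a i * F i U) := l2_self_nonneg_lat _
    have hout0 := l2_self_nonneg_lat (fun U => Real.sin (innerPhase (δ β) U) * ∑ i, a i * e i U)
    refine ⟨hnin0, by linarith, ?_⟩
    have hE0 : 0 ≤ Real.exp (-((levelGap k + 1) * bareLambda ((L : ℝ) ^ 3 * β))) * levelValue su2Rep L β 0 := by positivity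
    have hout_eq : l2 (fun U => Real.sin (innerPhase (δ β) U) * ∑ i, a i * e i U) (fun U => Real.sin (innerPhase (δ β) U) * ∑ i, a i * e i U)
        = ∑ i, a i ^ 2 - l2 (fun U => ∑ i, a i * F i U) (fun U => ∑ i, a i * F i U) := by linarith [hsplit]
    have h3 := hVal.trans (mul_le_mul_of_nonneg_left (hvalout.trans hout_eq.le) hE0)
    have h4 := mul_le_mul_of_nonneg_right herr (Finset.sum_nonneg fun i (_ : i ∈ Finset.univ) => sq_nonneg (a i))
    have h5 : levelValue su2Rep L β k * ∑ i, a i ^ 2 ≤ qform su2Rep β (fun U => ∑ i, a i * F i U) (fun U => ∑ i, a i * F i U)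
        + Real.exp (-((levelGap k + 1) * bareLambda ((L : ℝ) ^ 3 * β))) * levelValue su2Rep L β 0 *
            (∑ i, a i ^ 2 - l2 (fun U => ∑ i, a i * F i U) (fun U => ∑ i, a i * F i U))
        + K' * bareLambda ((L : ℝ) ^ 3 * β) * bareLambda ((L : ℝ) ^ 3 * β) * levelValue su2Rep L β 0 * ∑ i, a i ^ 2 := by
      linarith [honion, h3, h4, hfloorK]
    have h6 := mul_le_mul_of_nonneg_right h5 hμ0.le
    linarith [h6]
  -- nondegeneracy of the inner Gram matrix
  have hGram : ∀ a : Fin (k + 1) → ℝ, a ≠ 0 → 0 < l2 (fun U => ∑ i, a i * F i U) (fun U => ∑ i, a i * F i U) := by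
    intro a ha
    obtain ⟨hnin0, -, hkey⟩ := key a
    have hn : 0 < ∑ i, a i ^ 2 := sum_sq_pos_of_ne_zero ha
    rcases hnin0.lt_or_eq with hpos | hzero
    · exact hpos
    · exfalso
      have hq0 : qform su2Rep β (fun U => ∑ i, a i * F i U) (fun U => ∑ i, a i * F i U) ≤ 0 := by
        have h := qform_le_latCE_mul_l2 hβ0.le (isPhys_sum_mul_lat Finset.univ F hFphys a)
        rw [← hzero, mul_zero] at h; exact h
      rw [← hzero] at hkey
      exact absurd (gram_endgame hn hΛ0 hμ0.le hq0 hkey hB) (not_le.mpr H)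
  -- INNER NO-INTRUDER WITH RATE supplies a good combination: `e^{C_I λ²} ≤ e^{(ε/2)λ}` since `C_I λ ≤ 2K'λ = ε/2`
  obtain ⟨a, ha, hIa⟩ := hI' β hβI F hFphys hFsupp hGram
  obtain ⟨hnin0, hnin1, hkey⟩ := key a
  have hIa' : qform su2Rep β (fun U => ∑ i, a i * F i U) (fun U => ∑ i, a i * F i U) * levelValue su2Rep 1 ((L : ℝ) ^ 3 * β) 0 ≤
      Real.exp (4 * K' * bareLambda ((L : ℝ) ^ 3 * β) / 2 * bareLambda ((L : ℝ) ^ 3 * β)) * levelValue su2Rep 1 ((L : ℝ) ^ 3 * β) k *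
        levelValue su2Rep L β 0 * l2 (fun U => ∑ i, a i * F i U) (fun U => ∑ i, a i * F i U) := by
    refine hIa.trans ?_
    have hμkpos : 0 ≤ levelValue su2Rep 1 ((L : ℝ) ^ 3 * β) k := le_trans (by positivity) hμk'
    have hexpI : Real.exp (CI * bareLambda ((L : ℝ) ^ 3 * β) ^ 2) ≤ Real.exp (4 * K' * bareLambda ((L : ℝ) ^ 3 * β) / 2 * bareLambda ((L : ℝ) ^ 3 * β)) := by
      rw [Real.exp_le_exp]
      have := mul_le_mul_of_nonneg_right hCK' (sq_nonneg (bareLambda ((L : ℝ) ^ 3 * β)))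
      nlinarith
    exact mul_le_mul_of_nonneg_right (mul_le_mul_of_nonneg_right (mul_le_mul_of_nonneg_right hexpI hμkpos) hΛ0.le) hnin0
  exact absurd (bo_endgame (sum_sq_pos_of_ne_zero ha) hnin0 hnin1 hΛ0 hkey hIa' hA hB) (not_le.mpr H)

/-! ## §2 RED's polynomial scales are rate-admissible for `p ≤ 1/6`, `q ≤ 8/9` -/

/-- `e^{−x} ≤ 720 / x⁶` for `x > 0`. [folklore] -/
theorem exp_neg_le_div_pow_six {x : ℝ} (hx : 0 < x) : Real.exp (-x) ≤ 720 / x ^ 6 := by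
  have h := Real.pow_div_factorial_le_exp x hx.le 6
  have h6 : ((Nat.factorial 6 : ℕ) : ℝ) = 720 := by norm_num [Nat.factorial]
  rw [h6] at h
  rw [Real.exp_neg, le_div_iff₀ (by positivity)]
  have hx6 : 0 < x ^ 6 := by positivity
  have := (div_le_iff₀ (by norm_num : (0:ℝ) < 720)).mp h
  rw [inv_mul_le_iff₀ (Real.exp_pos x)]
  linarith

/-- ★ **Rate-admissibility of RED's polynomial scales**: for `0 < p ≤ 1/6` and `q ≤ 8/9` there are `K, β₀` with
`onionErr₂ L β (β^{−p}) (β^{−q}) ≤ K·λ_b(L³β)²·uniformFloorConst L` for `β ≥ β₀` (IMS term `∝ β^{2p−1} ≤ β^{−2/3}`, Boltzmann terms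
`≤ 6!·β^{−6(1−q)} ≤ 6!·β^{−2/3}`).  RED's exponent ledger `(p, q) = (1/40, 17/20)` qualifies. [cite: SimonB1983DiscreteSpectrum, §3] -/
theorem onionRate_powScale {p q : ℝ} (hp0 : 0 < p) (hp : p ≤ 1 / 6) (hq : q ≤ 8 / 9) :
    ∃ K βE : ℝ, ∀ β : ℝ, βE ≤ β →
      onionErr₂ L β (powScale p β) (powScale q β) ≤ K * bareLambda ((L : ℝ) ^ 3 * β) ^ 2 * uniformFloorConst L := by
  have hL : (0 : ℝ) < (L : ℝ) ^ 3 := by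
    have : (0 : ℝ) < L := by exact_mod_cast Nat.pos_of_ne_zero (NeZero.ne L)
    positivity
  have hfc := uniformFloorConst_pos (L := L)
  -- `λ_b(L³β)² = (2/L³)^{2/3} · β^{−2/3}`
  set A : ℝ := ((2 / (L : ℝ) ^ 3) ^ ((1 : ℝ) / 3)) ^ 2 with hA
  have hA0 : 0 < A := by rw [hA]; positivity
  -- the constant
  set E2 : ℝ := (Fintype.card (Edge 3 L) : ℝ) ^ 2 with hE2
  set M : ℝ := 720 + π ^ 2 / 8 * (720 * 2 ^ 6) + (1 / 2) * (E2 * 3 * (8 * π) ^ 2) with hM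
  have hM0 : 0 < M := by rw [hM]; positivity
  refine ⟨M / (A * uniformFloorConst L), 1, fun β hβ => ?_⟩
  have hβ0 : 0 < β := by linarith
  rw [powScale_eq hβ, powScale_eq hβ]
  have hlam2 : bareLambda ((L : ℝ) ^ 3 * β) ^ 2 = A * β ^ (-(2 : ℝ) / 3) := by
    rw [bareLambda_cube_eq (L := L) hβ0, mul_pow, hA]
    congr 1
    rw [← Real.rpow_natCast, ← Real.rpow_mul hβ0.le]
    norm_num
  rw [hlam2]
  have hrhs : M / (A * uniformFloorConst L) * (A * β ^ (-(2 : ℝ) / 3)) * uniformFloorConst L = M * β ^ (-(2 : ℝ) / 3) := by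
    field_simp
  rw [hrhs]
  -- the target power
  set t : ℝ := β ^ (-(2 : ℝ) / 3) with ht
  have ht0 : 0 < t := Real.rpow_pos_of_pos hβ0 _
  -- (i) IMS term: (3/β)·(8π/β^{-p})² = 3·(8π)²·β^{2p-1} ≤ 3(8π)² t
  have hIMS : (1 / 2) * (E2 * (3 / β) * (8 * π / β ^ (-p)) ^ 2) ≤ (1 / 2) * (E2 * 3 * (8 * π) ^ 2) * t := by
    have hβp : 0 < β ^ (-p) := Real.rpow_pos_of_pos hβ0 _
    have e1 : (3 / β) * (8 * π / β ^ (-p)) ^ 2 = 3 * (8 * π) ^ 2 * (β ^ (2 * p - 1)) := by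
      rw [div_pow, ← Real.rpow_natCast (β ^ (-p)) 2, ← Real.rpow_mul hβ0.le]
      have : β ^ (2 * p - 1) = β ^ (2 * p) * β⁻¹ := by
        rw [sub_eq_add_neg, Real.rpow_add hβ0, Real.rpow_neg_one]
      rw [this]
      have h2 : β ^ (-p * (2 : ℕ)) = (β ^ (2 * p))⁻¹ := by
        rw [← Real.rpow_neg hβ0.le]; congr 1; push_cast; ring
      rw [h2]
      field_simp
    have hpow : β ^ (2 * p - 1) ≤ t := by
      rw [ht]
      exact Real.rpow_le_rpow_of_exponent_le hβ (by linarith)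
    have hE20 : 0 ≤ E2 := by rw [hE2]; positivity
    calc (1 / 2) * (E2 * (3 / β) * (8 * π / β ^ (-p)) ^ 2)
        = (1 / 2) * (E2 * (3 * (8 * π) ^ 2 * β ^ (2 * p - 1))) := by rw [mul_assoc E2, e1]
      _ ≤ (1 / 2) * (E2 * (3 * (8 * π) ^ 2 * t)) := by
          apply mul_le_mul_of_nonneg_left _ (by norm_num)
          exact mul_le_mul_of_nonneg_left (mul_le_mul_of_nonneg_left hpow (by positivity)) hE20
      _ = (1 / 2) * (E2 * 3 * (8 * π) ^ 2) * t := by ring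
  -- (ii) Boltzmann terms: x = β·β^{-q} = β^{1-q} ≥ β^{1/9}; e^{-x} ≤ 720/x⁶ ≤ 720 β^{-6(1-q)} ≤ 720 t; e^{-x/2} ≤ 720·2⁶/x⁶
  have hx : β * β ^ (-q) = β ^ (1 - q) := by
    rw [sub_eq_add_neg, Real.rpow_add hβ0, Real.rpow_one]
  have hx0 : 0 < β ^ (1 - q) := Real.rpow_pos_of_pos hβ0 _
  have hx6 : 1 / (β ^ (1 - q)) ^ 6 ≤ t := by
    rw [← Real.rpow_natCast (β ^ (1 - q)) 6, ← Real.rpow_mul hβ0.le, one_div, ← Real.rpow_neg hβ0.le, ht]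
    refine Real.rpow_le_rpow_of_exponent_le hβ ?_
    push_cast
    nlinarith
  have hB1 : Real.exp (-(β * β ^ (-q))) ≤ 720 * t := by
    rw [hx]
    refine (exp_neg_le_div_pow_six hx0).trans ?_
    rw [div_eq_mul_one_div]
    exact mul_le_mul_of_nonneg_left hx6 (by norm_num)
  have hB2 : π ^ 2 / 8 * Real.exp (-(β * β ^ (-q) / 2)) ≤ π ^ 2 / 8 * (720 * 2 ^ 6) * t := by
    rw [hx]
    have h := exp_neg_le_div_pow_six (half_pos hx0)
    have e : (720 : ℝ) / (β ^ (1 - q) / 2) ^ 6 = 720 * 2 ^ 6 * (1 / (β ^ (1 - q)) ^ 6) := by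
      field_simp
    rw [e] at h
    have h' : Real.exp (-(β ^ (1 - q) / 2)) ≤ 720 * 2 ^ 6 * t :=
      h.trans (mul_le_mul_of_nonneg_left hx6 (by positivity))
    have := mul_le_mul_of_nonneg_left h' (by positivity : (0:ℝ) ≤ π ^ 2 / 8)
    linarith
  unfold onionErr₂
  rw [← hE2]
  calc Real.exp (-(β * β ^ (-q))) + π ^ 2 / 8 * Real.exp (-(β * β ^ (-q) / 2))
        + (1 / 2) * (E2 * (3 / β) * (8 * π / β ^ (-p)) ^ 2)
      ≤ 720 * t + π ^ 2 / 8 * (720 * 2 ^ 6) * t + (1 / 2) * (E2 * 3 * (8 * π) ^ 2) * t := by linarith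
    _ = M * t := by rw [hM]; ring

/-! ## §3 Level one: the hard stub's body and the leaf's body at one lattice size -/

/-- ★★ **The registered hard stub's body at `L` from VALLEY + INNER-with-rate at polynomial scales** (`0 < p ≤ 1/6`, `q ≤ 8/9`): for `β ≥ β₀`,
`λ₁(β,L)·μ₀(L³β) ≤ exp(C·λ_b(β)²/L)·μ₁(L³β)·λ₀(β,L)` (`λ_b(L³β)² = λ_b(β)²/L² ≤ λ_b(β)²/L`). [cite: Luscher1983, §3] [cite: LuscherMunster1984, §2] -/
theorem fixedLReductionAt_of_valley_innerRate {p q : ℝ} (hp0 : 0 < p) (hp : p ≤ 1 / 6) (hq : q ≤ 8 / 9)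
    (hV : ValleyGainAt L (powScale p) (powScale q))
    (hI : ∃ CI βI : ℝ, ∀ β : ℝ, βI ≤ β →
      ∀ F : Fin 2 → (GaugeConfig 3 L SU2 → ℝ), (∀ i, IsPhys (F i)) →
        (∀ i U, F i U ≠ 0 → ∃ z : Fin 3 → Bool, orbitDist (TT.twist3 z U) < powScale p β) →
        (∀ a : Fin 2 → ℝ, a ≠ 0 → 0 < l2 (fun U => ∑ i, a i * F i U) (fun U => ∑ i, a i * F i U)) →
          ∃ a : Fin 2 → ℝ, a ≠ 0 ∧
            qform su2Rep β (fun U => ∑ i, a i * F i U) (fun U => ∑ i, a i * F i U) * levelValue su2Rep 1 ((L : ℝ) ^ 3 * β) 0 ≤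
              Real.exp (CI * bareLambda ((L : ℝ) ^ 3 * β) ^ 2) * levelValue su2Rep 1 ((L : ℝ) ^ 3 * β) 1 *
                levelValue su2Rep L β 0 * l2 (fun U => ∑ i, a i * F i U) (fun U => ∑ i, a i * F i U)) :
    ∃ C β0 : ℝ, ∀ β : ℝ, β0 ≤ β →
      secondValue su2Rep L β * levelValue su2Rep 1 ((L : ℝ) ^ 3 * β) 0 ≤
        Real.exp (C * bareLambda β ^ 2 / L) * (levelValue su2Rep 1 ((L : ℝ) ^ 3 * β) 1 * topValue su2Rep L β) := by
  obtain ⟨C, β0, h⟩ := boUpperRate_of_valley_innerRate (L := L) 1 (fun β => powScale_pos p β) (fun β => powScale_pos q β)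
    (onionRate_powScale hp0 hp hq) hV hI
  refine ⟨|C|, max β0 1, fun β hβ => ?_⟩
  have hβ1 : 1 ≤ β := (le_max_right _ _).trans hβ
  have hβ0 : 0 < β := by linarith
  have hL1 : (1 : ℝ) ≤ L := by exact_mod_cast NeZero.one_le
  have hL : (0 : ℝ) < L := by linarith
  have H := h β ((le_max_left _ _).trans hβ)
  rw [levelValue_one su2Rep L β, levelValue_zero su2Rep L β] at H
  refine H.trans (mul_le_mul_of_nonneg_right (Real.exp_le_exp.2 ?_) ?_)
  · rw [bareLambda_cube_mul hβ0 L, div_pow]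
    have hv2 : 0 ≤ bareLambda β ^ 2 := sq_nonneg _
    have hL2 : (L : ℝ) ≤ (L : ℝ) ^ 2 := by nlinarith
    calc C * (bareLambda β ^ 2 / (L : ℝ) ^ 2) ≤ |C| * (bareLambda β ^ 2 / (L : ℝ) ^ 2) :=
          mul_le_mul_of_nonneg_right (le_abs_self C) (by positivity)
      _ ≤ |C| * (bareLambda β ^ 2 / L) := by
          apply mul_le_mul_of_nonneg_left _ (abs_nonneg C)
          exact div_le_div_of_nonneg_left hv2 hL hL2
      _ = |C| * bareLambda β ^ 2 / L := by ring
  · have hμ1 : 0 ≤ levelValue su2Rep 1 ((L : ℝ) ^ 3 * β) 1 := by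
      have hB : 0 < (L : ℝ) ^ 3 * β := by positivity
      exact (levelValue_su2Rep_pos hB 1).le
    exact mul_nonneg hμ1 (topValue_su2Rep_pos L β).le

/-- ★★ **The LEAF'S BODY at one lattice size `L`** from VALLEY + INNER-with-rate at polynomial scales (`0 < p ≤ 1/6`, `q ≤ 8/9`):
`∃ C β₀, ∀ β ≥ β₀, λ₁(β,L) ≤ exp(−(ε₁λ_b − Cλ_b²)/L)·λ₀(β,L)` — divide by `μ₀(L³β) > 0` using crux ONE at the scaled coupling
(`oneSiteAtScaledCoupling`). [cite: Luscher1983, §3] [cite: LuscherMunster1984, §2] -/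
theorem femtoGapFixedLatticeAt_of_valley_innerRate {p q : ℝ} (hp0 : 0 < p) (hp : p ≤ 1 / 6) (hq : q ≤ 8 / 9)
    (hV : ValleyGainAt L (powScale p) (powScale q))
    (hI : ∃ CI βI : ℝ, ∀ β : ℝ, βI ≤ β →
      ∀ F : Fin 2 → (GaugeConfig 3 L SU2 → ℝ), (∀ i, IsPhys (F i)) →
        (∀ i U, F i U ≠ 0 → ∃ z : Fin 3 → Bool, orbitDist (TT.twist3 z U) < powScale p β) →
        (∀ a : Fin 2 → ℝ, a ≠ 0 → 0 < l2 (fun U => ∑ i, a i * F i U) (fun U => ∑ i, a i * F i U)) →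
          ∃ a : Fin 2 → ℝ, a ≠ 0 ∧
            qform su2Rep β (fun U => ∑ i, a i * F i U) (fun U => ∑ i, a i * F i U) * levelValue su2Rep 1 ((L : ℝ) ^ 3 * β) 0 ≤
              Real.exp (CI * bareLambda ((L : ℝ) ^ 3 * β) ^ 2) * levelValue su2Rep 1 ((L : ℝ) ^ 3 * β) 1 *
                levelValue su2Rep L β 0 * l2 (fun U => ∑ i, a i * F i U) (fun U => ∑ i, a i * F i U)) :
    ∃ C β0 : ℝ, ∀ β : ℝ, β0 ≤ β →
      secondValue su2Rep L β ≤
        Real.exp (-(luscherEps1 * bareLambda β - C * bareLambda β ^ 2) / L) * topValue su2Rep L β := by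
  obtain ⟨C₁, β₁, h₁⟩ := fixedLReductionAt_of_valley_innerRate (L := L) hp0 hp hq hV hI
  obtain ⟨C₂, β₂, h₂⟩ := oneSiteAtScaledCoupling L
  refine ⟨|C₁| + C₂, max β₁ β₂, fun β hβ => ?_⟩
  have H₁ := h₁ β ((le_max_left _ _).trans hβ)
  obtain ⟨hμ0, H₂⟩ := h₂ β ((le_max_right _ _).trans hβ)
  set μ0 := levelValue su2Rep 1 ((L : ℝ) ^ 3 * β) 0
  set μ1 := levelValue su2Rep 1 ((L : ℝ) ^ 3 * β) 1
  set a := secondValue su2Rep L β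
  set b := topValue su2Rep L β
  set v := bareLambda β
  have hb : 0 ≤ b := (topValue_su2Rep_pos L β).le
  have hL : (0 : ℝ) < L := by exact_mod_cast NeZero.pos L
  have step : a * μ0 ≤ Real.exp (C₁ * v ^ 2 / L) * (Real.exp (-(luscherEps1 * v - C₂ * v ^ 2) / L) * μ0) * b := by
    calc a * μ0 ≤ Real.exp (C₁ * v ^ 2 / L) * (μ1 * b) := H₁
      _ ≤ Real.exp (C₁ * v ^ 2 / L) * ((Real.exp (-(luscherEps1 * v - C₂ * v ^ 2) / L) * μ0) * b) :=
          mul_le_mul_of_nonneg_left (mul_le_mul_of_nonneg_right H₂ hb) (Real.exp_pos _).le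
      _ = _ := by ring
  have hE : Real.exp (C₁ * v ^ 2 / L) * Real.exp (-(luscherEps1 * v - C₂ * v ^ 2) / L) ≤
      Real.exp (-(luscherEps1 * v - (|C₁| + C₂) * v ^ 2) / L) := by
    rw [← Real.exp_add, Real.exp_le_exp, ← add_div, div_le_div_iff_of_pos_right hL]
    have : C₁ * v ^ 2 ≤ |C₁| * v ^ 2 := mul_le_mul_of_nonneg_right (le_abs_self _) (sq_nonneg v)
    linarith
  have key : a * μ0 ≤ (Real.exp (-(luscherEps1 * v - (|C₁| + C₂) * v ^ 2) / L) * b) * μ0 := by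
    calc a * μ0 ≤ Real.exp (C₁ * v ^ 2 / L) * (Real.exp (-(luscherEps1 * v - C₂ * v ^ 2) / L) * μ0) * b := step
      _ = (Real.exp (C₁ * v ^ 2 / L) * Real.exp (-(luscherEps1 * v - C₂ * v ^ 2) / L)) * b * μ0 := by ring
      _ ≤ Real.exp (-(luscherEps1 * v - (|C₁| + C₂) * v ^ 2) / L) * b * μ0 :=
          mul_le_mul_of_nonneg_right (mul_le_mul_of_nonneg_right hE hb) hμ0.le
  exact le_of_mul_le_mul_right key hμ0

end Summit.QuantumFields.YangMills.Theorems.FemtoCutoffLadder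

end
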